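import Summits.ABC.StewartYu.PadicG3TwoBudgetTN
import Summits.ABC.StewartYu.PadicG3TwoClose
import HarnessLib

/-!
# Crux `PadicCoreTwoRat` (stmt-ABC-20504) of route `YuMatveevShapeRat`, line `padic-two-sat-frame`: the registered stub
# `stub_linesTwoN`/`stub_linesTwoNW` — the GAIN BRANCHES (L2₀)/(L2)/(L3) of the schedule of record `schedTwoN` at the padded record

Cell abc-stewartyu (HOME `run/shared/lean/pub/abc-stewartyu/`), WP-L.P(2) lead p3 (g10).  Theorems only.

**`stub_linesTwoNW`** (registered twin of the skeleton's `stub_linesTwoN`, stated by the tree `Prop`) = `TwoSetup.LinesSupplyTwoNW`: for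
every crux datum (set-up `S`, saturation datum `F`, weights `V`, letter `W`, basis slot `Ucol`, size data (s1)–(s5) at the crux letter)
the three gain-branch families of the gain pack at the padded record `P = ParTwo.parTwo V Vmax (W + c_W d)`, from the budget lines for an
arbitrary admissible ledger — `TwoSetup.hL2zero_gain_schedTwoN`, `TwoSetup.hL2_gain_schedTwoN` (`PadicG3TwoBudgetKN`) and
`TwoSetup.hL3_gain_schedTwoN` (`PadicG3TwoBudgetTN`) — at the ledger identities of `parTwo` (`TwoSetup.parTwo_G_eq`, `parTwo_Nq_eq`,
`parTwo_yload`, `ParTwo.parTwo_Ω`; `P.A = V`, `P.W = W + c_W d` by `rfl`).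

References: Yu. V. Nesterenko, LNM 1819 (2003), §4.2 Cor 4.5, §4.3; K. Yu, Acta Math. 211 (2013), Lemma 5.2 (5.28)–(5.41), Lemma 5.4.
-/

noncomputable section

-- `Summit.<Summit>.<Problem>` is the mandated summit-side namespace (CONVENTIONS §2); for the single-conjunct summit `ABC` the two
-- coincide, so the duplicate `ABC.ABC` is deliberate.
set_option linter.dupNamespace false

namespace Summit.ABC.ABC.Theorems

open Finset
open Summit.ABC.StewartYu Summit.ABC.StewartYu.TwoSetup Summit.ABC.StewartYu.PadicG3Par

/-- **The registered stub `stub_linesTwoNW` (= the skeleton's `stub_linesTwoN`) of crux stmt-ABC-20504** (line `padic-two-sat-frame`):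
the lines supply `TwoSetup.LinesSupplyTwoNW` — the gain branches of (L2₀)/(L2)/(L3) of `schedTwoN` at the padded record for every crux datum.
[cite: Nesterenko2003, §4.2 Cor 4.5, §4.3] [cite: Yu2013, Lemma 5.2 (5.28)–(5.31), Lemma 5.4 (5.58)–(5.70)] -/
theorem stub_linesTwoNW : Summit.ABC.StewartYu.TwoSetup.LinesSupplyTwoNW := by
  intro S F V Vmax W Ucol _hd hV1 hVmax hW1 hs1 hs2 hs3 hs4 hs5 P
  have hWt := one_le_padW hW1 S.d
  have hG : P.G = (P.m + 2) * Real.log 2 := TwoSetup.parTwo_G_eq V Vmax (W + (cW S.d : ℝ)) hV1 hVmax hWt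
  have hNq : P.Nq = 2 ^ (P.m + 2) := TwoSetup.parTwo_Nq_eq V Vmax (W + (cW S.d : ℝ)) hV1 hVmax hWt
  have hy : 2 * P.G ≤ P.yload := TwoSetup.parTwo_yload V Vmax (W + (cW S.d : ℝ)) hV1 hVmax hWt
  have hA1 : ∀ j, 1 ≤ P.A j := hV1
  have hΩ : P.Ω = ∏ j, V j := ParTwo.parTwo_Ω V Vmax (W + (cW S.d : ℝ)) hV1 hVmax hWt
  have hN : (F.N : ℝ) ≤ (2 / Real.log 2) ^ (S.d + 1) * P.Ω := by rw [hΩ]; exact hs4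
  have hVo : ∀ j, Height.logHeight₁ (F.αo j) ≤ 2 * P.A j := hs1
  have hall : ∀ k, Height.logHeight₁ (S.toQ.all k) ≤ 2 * ∑ j, P.A j := hs2
  have hWP : P.W = W + (cW S.d : ℝ) := rfl
  have hpad : W + (cW S.d : ℝ) ≤ P.W := le_of_eq hWP.symm
  have hcW : (cW S.d : ℝ) ≤ P.W := by rw [hWP]; linarith
  exact ⟨S.hL2zero_gain_schedTwoN F P hG hy hNq hA1 hN hVo hs3 hpad hcW,
    S.hL2_gain_schedTwoN F P hG hy hNq hA1 hN hVo hs3 hpad hcW,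
    S.hL3_gain_schedTwoN F P Ucol hG hy hNq hA1 hN hVo hall hs3 hpad hcW hs5⟩

end Summit.ABC.ABC.Theorems

end
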